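import Summits.MatrixMultiplication.MatrixMultiplication.Theses.DesignFlattening

/-!
# `stub_weightCompletion` of line `toric-punctures` (crux GrowingHostDesigns, stmt-MatrixMultiplication-8033) — PROOF

Level-set completions of powers of a torically punctured table: given weights `wa wb wc : G → ℤ` with
`wa(u+v) + wb(u) + wc(v) ≥ 0` everywhere and `= 0 ↔ (u,v) ∈ P`, the indicator
`S_N(a;b,c) := [WA a + WB b + WC c = 0]` (`WA a = Σ_t wa (a t)` …) satisfies `T_P^{⊗N} = U_G^{⊗N} ∘ S_N`
entrywise and is a sum of `|range WA| · |range WB| ≤ C · (N+1)²` triads, `C = (2Σ|wa|+1)(2Σ|wb|+1)`.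
-/

set_option linter.dupNamespace false

namespace Summit.MatrixMultiplication.MatrixMultiplication.Cruxes.GrowingHostDesigns.ToricPuncturesProofs

open Literature.Computability.AlgebraicComplexity
open scoped BigOperators

/-- Range bound: a sum of `N` values of `w` lies in `[-N·K, N·K]` with `K = Σ_g |w g|`. -/
theorem abs_sum_le_mul {G : Type} [Fintype G] {N : ℕ} (w : G → ℤ) (a : Fin N → G) :
    |∑ t, w (a t)| ≤ (N : ℤ) * ∑ g, |w g| := by
  calc |∑ t, w (a t)| ≤ ∑ t, |w (a t)| := Finset.abs_sum_le_sum_abs _ _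
    _ ≤ ∑ _t : Fin N, ∑ g, |w g| := Finset.sum_le_sum fun t _ =>
        Finset.single_le_sum (f := fun g => |w g|) (fun g _ => abs_nonneg _) (Finset.mem_univ (a t))
    _ = (N : ℤ) * ∑ g, |w g| := by simp

/-- The image of the summed weight lies in an integer interval of length `2·N·K + 1`. -/
theorem card_image_sum_le {G : Type} [Fintype G] [DecidableEq G] {N : ℕ} (w : G → ℤ) :
    (((Finset.univ : Finset (Fin N → G)).image fun a => ∑ t, w (a t)).card : ℤ) ≤
      2 * (N : ℤ) * (∑ g, |w g|) + 1 := by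
  set K : ℤ := ∑ g, |w g| with hK
  have hK0 : 0 ≤ K := Finset.sum_nonneg fun g _ => abs_nonneg _
  have hsub : ((Finset.univ : Finset (Fin N → G)).image fun a => ∑ t, w (a t)) ⊆
      Finset.Icc (-((N : ℤ) * K)) ((N : ℤ) * K) := by
    intro x hx
    rw [Finset.mem_image] at hx
    obtain ⟨a, _, rfl⟩ := hx
    have h := abs_sum_le_mul w a
    rw [abs_le] at h
    exact Finset.mem_Icc.2 h
  have hcard := Finset.card_le_card hsub
  rw [Int.card_Icc] at hcard
  have hnn : (0 : ℤ) ≤ (N : ℤ) * K + 1 - -((N : ℤ) * K) := by nlinarith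
  calc (((Finset.univ : Finset (Fin N → G)).image fun a => ∑ t, w (a t)).card : ℤ)
      ≤ (((N : ℤ) * K + 1 - -((N : ℤ) * K)).toNat : ℤ) := by exact_mod_cast hcard
    _ = (N : ℤ) * K + 1 - -((N : ℤ) * K) := Int.toNat_of_nonneg hnn
    _ = 2 * (N : ℤ) * K + 1 := by ring

theorem stub_weightCompletion_proof :
    ∀ (G : Type) [AddCommGroup G] [Fintype G] [DecidableEq G] (P : Finset (G × G))
      (wa wb wc : G → ℤ),
      (∀ u v : G, 0 ≤ wa (u + v) + wb u + wc v ∧ (wa (u + v) + wb u + wc v = 0 ↔ (u, v) ∈ P)) →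
      ∃ C : ℝ, ∀ N : ℕ, ∃ S : (Fin N → G) → (Fin N → G) → (Fin N → G) → ℂ,
        (∀ a b c : Fin N → G,
          kroneckerPow (fun a b c : G => if b + c = a ∧ (b, c) ∈ P then (1 : ℂ) else 0) N a b c =
            kroneckerPow (fun a b c : G => if b + c = a then (1 : ℂ) else 0) N a b c * S a b c) ∧
        (tensorRank S : ℝ) ≤ C * ((N : ℝ) + 1) ^ 2 := by
  intro G _ _ _ P wa wb wc hw
  classical
  set Ka : ℤ := ∑ g, |wa g| with hKa
  set Kb : ℤ := ∑ g, |wb g| with hKb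
  have hKa0 : 0 ≤ Ka := Finset.sum_nonneg fun g _ => abs_nonneg _
  have hKb0 : 0 ≤ Kb := Finset.sum_nonneg fun g _ => abs_nonneg _
  refine ⟨(((2 * Ka + 1) * (2 * Kb + 1) : ℤ) : ℝ), fun N => ?_⟩
  -- summed weights and the level-set completion
  set WA : (Fin N → G) → ℤ := fun a => ∑ t, wa (a t) with hWA
  set WB : (Fin N → G) → ℤ := fun b => ∑ t, wb (b t) with hWB
  set WC : (Fin N → G) → ℤ := fun c => ∑ t, wc (c t) with hWC
  refine ⟨fun a b c => if WA a + WB b + WC c = 0 then 1 else 0, ?_, ?_⟩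
  · -- the completion identity
    intro a b c
    dsimp only
    rw [kroneckerPow_apply, kroneckerPow_apply]
    by_cases hsum : ∀ t, b t + c t = a t
    · have hU : (∏ t, (if b t + c t = a t then (1 : ℂ) else 0)) = 1 :=
        Finset.prod_eq_one fun t _ => by rw [if_pos (hsum t)]
      rw [hU, one_mul]
      have hT : (∏ t, (if b t + c t = a t ∧ (b t, c t) ∈ P then (1 : ℂ) else 0)) =
          ∏ t, (if (b t, c t) ∈ P then (1 : ℂ) else 0) :=
        Finset.prod_congr rfl fun t _ => by simp [hsum t]
      rw [hT, Finset.prod_boole]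
      have key : WA a + WB b + WC c = 0 ↔ ∀ t ∈ (Finset.univ : Finset (Fin N)), (b t, c t) ∈ P := by
        have hre : WA a + WB b + WC c = ∑ t, (wa (b t + c t) + wb (b t) + wc (c t)) := by
          simp only [hWA, hWB, hWC, ← Finset.sum_add_distrib]
          refine Finset.sum_congr rfl fun t _ => ?_
          rw [hsum t]
        rw [hre, Finset.sum_eq_zero_iff_of_nonneg (fun t _ => (hw (b t) (c t)).1)]
        exact ⟨fun h t ht => ((hw _ _).2).1 (h t ht), fun h t ht => ((hw _ _).2).2 (h t ht)⟩
      by_cases hall : ∀ t ∈ (Finset.univ : Finset (Fin N)), (b t, c t) ∈ P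
      · rw [if_pos hall, if_pos (key.2 hall)]
      · rw [if_neg hall, if_neg (fun h => hall (key.1 h))]
    · push Not at hsum
      obtain ⟨t, ht⟩ := hsum
      have h0 : (∏ t, (if b t + c t = a t then (1 : ℂ) else 0)) = 0 :=
        Finset.prod_eq_zero (Finset.mem_univ t) (by rw [if_neg ht])
      have h0' : (∏ t, (if b t + c t = a t ∧ (b t, c t) ∈ P then (1 : ℂ) else 0)) = 0 :=
        Finset.prod_eq_zero (Finset.mem_univ t) (by rw [if_neg (fun h => ht h.1)])
      rw [h0, h0', zero_mul]
  · -- rank: a sum of |range WA| · |range WB| triads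
    set RA : Finset ℤ := (Finset.univ : Finset (Fin N → G)).image WA with hRA
    set RB : Finset ℤ := (Finset.univ : Finset (Fin N → G)).image WB with hRB
    have hdecomp : (fun a b c => if WA a + WB b + WC c = 0 then (1 : ℂ) else 0) =
        ∑ s : ↥(RA ×ˢ RB), triad (fun a => if WA a = s.1.1 then (1 : ℂ) else 0)
          (fun b => if WB b = s.1.2 then (1 : ℂ) else 0)
          (fun c => if WC c = -s.1.1 - s.1.2 then (1 : ℂ) else 0) := by
      funext a b c
      rw [Finset.sum_apply, Finset.sum_apply, Finset.sum_apply]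
      simp only [triad_apply]
      have hmem : (WA a, WB b) ∈ RA ×ˢ RB :=
        Finset.mem_product.2 ⟨Finset.mem_image_of_mem _ (Finset.mem_univ a),
          Finset.mem_image_of_mem _ (Finset.mem_univ b)⟩
      rw [Finset.sum_eq_single (⟨(WA a, WB b), hmem⟩ : ↥(RA ×ˢ RB))]
      · simp only [if_true]
        by_cases h : WA a + WB b + WC c = 0
        · rw [if_pos h, if_pos (by linarith)]; ring
        · rw [if_neg h, if_neg (fun h' => h (by linarith))]; ring
      · rintro ⟨⟨i, j⟩, hij⟩ _ hne
        have hne' : ¬ (WA a = i ∧ WB b = j) := by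
          rintro ⟨rfl, rfl⟩
          exact hne rfl
        by_cases hi : WA a = i
        · have hj : ¬ WB b = j := fun hj => hne' ⟨hi, hj⟩
          simp [hj]
        · simp [hi]
      · intro h
        exact absurd (Finset.mem_univ _) h
    have hrank : tensorRank (fun a b c => if WA a + WB b + WC c = 0 then (1 : ℂ) else 0) ≤
        Fintype.card ↥(RA ×ˢ RB) := tensorRank_le_card_of_eq_sum _ _ _ hdecomp
    rw [Fintype.card_coe, Finset.card_product] at hrank
    have hA : (RA.card : ℤ) ≤ 2 * (N : ℤ) * Ka + 1 := card_image_sum_le wa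
    have hB : (RB.card : ℤ) ≤ 2 * (N : ℤ) * Kb + 1 := card_image_sum_le wb
    have hA' : (RA.card : ℝ) ≤ (2 * Ka + 1 : ℤ) * ((N : ℝ) + 1) := by
      have h1 : ((RA.card : ℤ) : ℝ) ≤ ((2 * (N : ℤ) * Ka + 1 : ℤ) : ℝ) := by exact_mod_cast hA
      have h2 : ((2 * (N : ℤ) * Ka + 1 : ℤ) : ℝ) ≤ (2 * Ka + 1 : ℤ) * ((N : ℝ) + 1) := by
        push_cast
        have : (0 : ℝ) ≤ (Ka : ℝ) := by exact_mod_cast hKa0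
        nlinarith
      exact_mod_cast h1.trans h2
    have hB' : (RB.card : ℝ) ≤ (2 * Kb + 1 : ℤ) * ((N : ℝ) + 1) := by
      have h1 : ((RB.card : ℤ) : ℝ) ≤ ((2 * (N : ℤ) * Kb + 1 : ℤ) : ℝ) := by exact_mod_cast hB
      have h2 : ((2 * (N : ℤ) * Kb + 1 : ℤ) : ℝ) ≤ (2 * Kb + 1 : ℤ) * ((N : ℝ) + 1) := by
        push_cast
        have : (0 : ℝ) ≤ (Kb : ℝ) := by exact_mod_cast hKb0
        nlinarith
      exact_mod_cast h1.trans h2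
    have hKa1 : (0 : ℝ) ≤ ((2 * Ka + 1 : ℤ) : ℝ) := by exact_mod_cast (by linarith : (0 : ℤ) ≤ 2 * Ka + 1)
    calc (tensorRank (fun a b c => if WA a + WB b + WC c = 0 then (1 : ℂ) else 0) : ℝ)
        ≤ ((RA.card * RB.card : ℕ) : ℝ) := by exact_mod_cast hrank
      _ = (RA.card : ℝ) * (RB.card : ℝ) := by push_cast; ring
      _ ≤ ((2 * Ka + 1 : ℤ) * ((N : ℝ) + 1)) * ((2 * Kb + 1 : ℤ) * ((N : ℝ) + 1)) :=
          mul_le_mul hA' hB' (Nat.cast_nonneg _) (mul_nonneg hKa1 (by positivity))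
      _ = (((2 * Ka + 1) * (2 * Kb + 1) : ℤ) : ℝ) * ((N : ℝ) + 1) ^ 2 := by push_cast; ring

end Summit.MatrixMultiplication.MatrixMultiplication.Cruxes.GrowingHostDesigns.ToricPuncturesProofs
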